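import Mathlib
import Literature.NumberTheory.LFunctions.Zhang2022.SmoothWeightMellin
import HarnessLib

/-!
# Zhang (2022) §17 (17.3)/(17.8), §15 p. 81: "By trivial estimation, the contribution from the terms
# with `m ≠ n` is `o(p)`" — extracting the diagonal after integrating term by term

Topic `Literature/NumberTheory/LFunctions/Zhang2022` (Landau–Siegel audit tree; verdict-neutral).
Y. Zhang, *Discrete mean estimates and the Landau–Siegel zero*, arXiv:2211.02515v1 (2022)
[Zhang2022LandauSiegel] — **an unrefereed manuscript under adjudication** (cell siegel-zhang, D-0069).
Companion of `Zhang2022/SmoothWeightMellin.lean`: after "integrating term by term" the manuscript is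
left (§17 p. 96, `Z22:§17.u005`, tex L4723–4727; likewise (17.8) p. 98 and `Z22:§15.u012` p. 81) with
`Σ_m Σ_{n<N} T(m,n)·X_p(m,n)`, `T(m,n) = a(m)m^{−s₀}·b(n)n^{s₀−1}·exp{−𝓛₂² log²(n/m)}`,
`X_p(m,n) = Σ*_{ψ (mod p)} ψ(m)ψ̄(n)`, and says: "By trivial estimation, the contribution from the
terms with `m ≠ n` above is `o(p)`. Hence (17.3)" [tex L4726–4728]. This file PROVES the trivial
estimation as an explicit inequality, for ANY weights `X(m,n)` with `|X(m,n)| ≤ X₁` when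
`m ≠ n, m < p` and `|X(m,n)| ≤ X₂` when `m ≥ p` (for the character sum: `X₁ = 1`, `X₂ = p − 1`,
`PrimitiveCharOrthogonality.lean`), any Dirichlet series `a` absolutely convergent at `σ = 3/2`, any
`b`, and `S ⊆ [1, N]`, `N < p`, `𝓛₂² log(p/N) ≥ 1`:

* `SmoothWeight.norm_offDiagonal_le`:
  `‖Σ_m Σ_{n∈S, n≠m} T(m,n)X(m,n)‖ ≤ (Σ_m|a(m)|m^{−3/2})(Σ_{n∈S}|b(n)|√n)(X₁e^{1/(4𝓛₂²)} + X₂e^{−u₀(𝓛₂²u₀−1)})`,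
  `u₀ = log(p/N)` — the two exponentials come from `m·e^{−𝓛₂² log²(m/n)} ≤ n·e^{1/(4𝓛₂²)}` (all `m`)
  and `≤ n·e^{−u₀(𝓛₂²u₀−1)}` (`m ≥ p`); at the manuscript's `N = D⁴`, `p ∼ P = e^{𝓛⁹}`,
  `𝓛₂ = 𝓛⁴⁰⁰` the second term is `p·exp{−𝓛⁸⁰⁰(𝓛⁹−4𝓛)²/…}`-negligible and the whole bound is
  polynomial in `D`, i.e. `o(p)`, once `Σ|a(m)|m^{−3/2} ≪ 1` (divisor-type coefficients);
* `SmoothWeight.sum_diagonal_eq`: the diagonal `Σ_{n∈S} T(n,n)X(n,n) = X_d·Σ_{n∈S} a(n)b(n)/n` when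
  `X(n,n) = X_d` on `S` (for `Σ*_{ψ (mod p)}`: `X_d = p − 2`);
* `SmoothWeight.tsum_eq_diagonal_add_offDiagonal`: the split of the double sum (with the summability
  it needs).

UNCONDITIONAL (no (A), no named fact); nothing here bears on Theorems 1–2 of the source or on the
cell's verdict.

## References

* Y. Zhang, arXiv:2211.02515v1 (2022), §17 p. 96 ((17.3)), p. 98 ((17.8)); §15 p. 81.
  [cite: Zhang2022LandauSiegel, §17 (17.3); §17 (17.8); §15 p. 81]
-/

noncomputable section

open Complex Real

namespace Literature.NumberTheory.LFunctions.Zhang2022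

namespace SmoothWeight

/-! ## The size of one term -/

/-- `u − L²u² ≤ 1/(4L²)` (complete the square). [folklore] -/
private theorem sub_sq_le (L u : ℝ) (hL : 0 < L) : u - L ^ 2 * u ^ 2 ≤ 1 / (4 * L ^ 2) := by
  rw [le_div_iff₀ (by positivity)]
  nlinarith [sq_nonneg (2 * L ^ 2 * u - 1), sq_nonneg L]

/-- For `u ≥ u₀` with `L²u₀ ≥ 1`: `u − L²u² ≤ −u₀(L²u₀ − 1)`. [folklore] -/
private theorem sub_sq_le_of_le {L u u₀ : ℝ} (hu₀ : 1 ≤ L ^ 2 * u₀) (hu : u₀ ≤ u) :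
    u - L ^ 2 * u ^ 2 ≤ -(u₀ * (L ^ 2 * u₀ - 1)) := by
  have h1 : 0 ≤ L ^ 2 * u₀ - 1 := by linarith
  have h0 : 0 ≤ u₀ := by nlinarith [sq_nonneg L]
  have hLu : L ^ 2 * u₀ - 1 ≤ L ^ 2 * u - 1 := by nlinarith [sq_nonneg L]
  nlinarith [mul_le_mul hu hLu h1 (h0.trans hu)]

/-- **The norm of one term** `T(m,n) = a(m)m^{−s₀}·b(n)n^{s₀−1}·e^{−𝓛₂² log²(n/m)}`, `m, n ≥ 1`:
`|T(m,n)| = |a(m)|m^{−1/2}·|b(n)|n^{−1/2}·e^{−𝓛₂² log²(n/m)}` (`Re s₀ = 1/2`).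
[cite: Zhang2022LandauSiegel, §17 p. 96 (before (17.3))] -/
theorem norm_term_mul_eq {L₂ : ℝ} (t₀ : ℝ) (a b : ℕ → ℂ) {m n : ℕ} (hm : m ≠ 0) (hn : n ≠ 0) :
    ‖LSeries.term a (s0 t₀) m * (b n * (n : ℂ) ^ (s0 t₀ - 1)) *
        cexp (-(L₂ : ℂ) ^ 2 * (Real.log ((n : ℝ) / m) : ℂ) ^ 2)‖
      = ‖a m‖ * (m : ℝ) ^ (-(1 / 2 : ℝ)) * (‖b n‖ * (n : ℝ) ^ (-(1 / 2 : ℝ))) *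
          Real.exp (-(L₂ ^ 2 * Real.log ((n : ℝ) / m) ^ 2)) := by
  have hm' : (0 : ℝ) < m := Nat.cast_pos.mpr (Nat.pos_of_ne_zero hm)
  have hn' : (0 : ℝ) < n := Nat.cast_pos.mpr (Nat.pos_of_ne_zero hn)
  have hre : (s0 t₀).re = 1 / 2 := by rw [s0_def]; simp
  have hexp : ‖cexp (-(L₂ : ℂ) ^ 2 * (Real.log ((n : ℝ) / m) : ℂ) ^ 2)‖
      = Real.exp (-(L₂ ^ 2 * Real.log ((n : ℝ) / m) ^ 2)) := by
    rw [Complex.norm_exp]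
    congr 1
    have : (-(L₂ : ℂ) ^ 2 * (Real.log ((n : ℝ) / m) : ℂ) ^ 2)
        = ((-(L₂ ^ 2 * Real.log ((n : ℝ) / m) ^ 2) : ℝ) : ℂ) := by push_cast; ring
    rw [this, ofReal_re]
  rw [norm_mul, norm_mul, norm_mul, LSeries.norm_term_eq, if_neg hm, hre,
    ← Complex.ofReal_natCast n, Complex.norm_cpow_eq_rpow_re_of_pos hn', sub_re, hre, one_re, hexp,
    Real.rpow_neg hm'.le, div_eq_mul_inv]
  norm_num

/-- **"Trivial estimation", the Gaussian gives back one power of `m`**: for `m, n ≥ 1`,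
`m^{−1/2}n^{−1/2}e^{−𝓛₂² log²(n/m)} ≤ m^{−3/2}·n^{1/2}·e^{1/(4𝓛₂²)}`
(`(m/n)e^{−𝓛₂²log²(m/n)} = e^{u−𝓛₂²u²} ≤ e^{1/(4𝓛₂²)}`, `u = log(m/n)`).
[cite: Zhang2022LandauSiegel, §17 p. 96 ("By trivial estimation")] -/
theorem rpow_mul_rpow_mul_exp_le {L₂ : ℝ} (hL : 0 < L₂) {m n : ℕ} (hm : m ≠ 0) (hn : n ≠ 0) :
    (m : ℝ) ^ (-(1 / 2 : ℝ)) * (n : ℝ) ^ (-(1 / 2 : ℝ)) * Real.exp (-(L₂ ^ 2 * Real.log ((n : ℝ) / m) ^ 2))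
      ≤ (m : ℝ) ^ (-(3 / 2 : ℝ)) * (n : ℝ) ^ (1 / 2 : ℝ) * Real.exp (1 / (4 * L₂ ^ 2)) := by
  have hm' : (0 : ℝ) < m := Nat.cast_pos.mpr (Nat.pos_of_ne_zero hm)
  have hn' : (0 : ℝ) < n := Nat.cast_pos.mpr (Nat.pos_of_ne_zero hn)
  set u : ℝ := Real.log ((m : ℝ) / n) with hu
  have hlog : Real.log ((n : ℝ) / m) = -u := by
    rw [hu, ← Real.log_inv, inv_div]
  have hmn : (m : ℝ) / n = Real.exp u := by rw [hu, Real.exp_log (div_pos hm' hn')]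
  -- rewrite the left side as `m^{−3/2} n^{1/2} · (m/n) e^{−L²u²}`
  have e1 : (m : ℝ) ^ (-(1 / 2 : ℝ)) = (m : ℝ) ^ (-(3 / 2 : ℝ)) * m := by
    rw [show (-(1 / 2 : ℝ)) = -(3 / 2 : ℝ) + 1 by norm_num, Real.rpow_add hm', Real.rpow_one]
  have e2 : (n : ℝ) ^ (-(1 / 2 : ℝ)) = (n : ℝ) ^ (1 / 2 : ℝ) * (n : ℝ)⁻¹ := by
    rw [show (-(1 / 2 : ℝ)) = (1 / 2 : ℝ) + (-1) by norm_num, Real.rpow_add hn', Real.rpow_neg_one]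
  rw [e1, e2, hlog, neg_sq]
  have key : (m : ℝ) * (n : ℝ)⁻¹ * Real.exp (-(L₂ ^ 2 * u ^ 2)) ≤ Real.exp (1 / (4 * L₂ ^ 2)) := by
    rw [← div_eq_mul_inv, hmn, ← Real.exp_add]
    exact Real.exp_le_exp.mpr (by linarith [sub_sq_le L₂ u hL])
  have h0 : 0 ≤ (m : ℝ) ^ (-(3 / 2 : ℝ)) * (n : ℝ) ^ (1 / 2 : ℝ) := by positivity
  calc (m : ℝ) ^ (-(3 / 2 : ℝ)) * m * ((n : ℝ) ^ (1 / 2 : ℝ) * (n : ℝ)⁻¹) *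
        Real.exp (-(L₂ ^ 2 * u ^ 2))
      = (m : ℝ) ^ (-(3 / 2 : ℝ)) * (n : ℝ) ^ (1 / 2 : ℝ) *
          ((m : ℝ) * (n : ℝ)⁻¹ * Real.exp (-(L₂ ^ 2 * u ^ 2))) := by ring
    _ ≤ (m : ℝ) ^ (-(3 / 2 : ℝ)) * (n : ℝ) ^ (1 / 2 : ℝ) * Real.exp (1 / (4 * L₂ ^ 2)) :=
        mul_le_mul_of_nonneg_left key h0

/-- **The far terms `m ≥ p`**: if `n ≤ N < p ≤ m` and `𝓛₂² log(p/N) ≥ 1`, then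
`m^{−1/2}n^{−1/2}e^{−𝓛₂² log²(n/m)} ≤ m^{−3/2}·n^{1/2}·e^{−u₀(𝓛₂²u₀ − 1)}`, `u₀ = log(p/N)`
(here `u = log(m/n) ≥ u₀`, and `u − 𝓛₂²u² ≤ −u₀(𝓛₂²u₀−1)`).
[cite: Zhang2022LandauSiegel, §17 p. 96 ("By trivial estimation")] -/
theorem rpow_mul_rpow_mul_exp_le_far {L₂ : ℝ} {m n N p : ℕ} (hn : n ≠ 0) (hnN : n ≤ N)
    (hNp : N < p) (hpm : p ≤ m) (hu₀ : 1 ≤ L₂ ^ 2 * Real.log ((p : ℝ) / N)) :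
    (m : ℝ) ^ (-(1 / 2 : ℝ)) * (n : ℝ) ^ (-(1 / 2 : ℝ)) * Real.exp (-(L₂ ^ 2 * Real.log ((n : ℝ) / m) ^ 2))
      ≤ (m : ℝ) ^ (-(3 / 2 : ℝ)) * (n : ℝ) ^ (1 / 2 : ℝ) *
          Real.exp (-(Real.log ((p : ℝ) / N) * (L₂ ^ 2 * Real.log ((p : ℝ) / N) - 1))) := by
  have hn' : (0 : ℝ) < n := Nat.cast_pos.mpr (Nat.pos_of_ne_zero hn)
  have hN' : (0 : ℝ) < N := lt_of_lt_of_le hn' (by exact_mod_cast hnN)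
  have hp' : (0 : ℝ) < p := hN'.trans (by exact_mod_cast hNp)
  have hm' : (0 : ℝ) < m := lt_of_lt_of_le hp' (by exact_mod_cast hpm)
  set u : ℝ := Real.log ((m : ℝ) / n) with hu
  set u₀ : ℝ := Real.log ((p : ℝ) / N) with hu₀'
  have hlog : Real.log ((n : ℝ) / m) = -u := by
    rw [hu, ← Real.log_inv, inv_div]
  have hmn : (m : ℝ) / n = Real.exp u := by rw [hu, Real.exp_log (div_pos hm' hn')]
  have huu : u₀ ≤ u := by
    rw [hu, hu₀']
    exact Real.log_le_log (div_pos hp' hN')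
      (div_le_div₀ hm'.le (by exact_mod_cast hpm) hn' (by exact_mod_cast hnN))
  have e1 : (m : ℝ) ^ (-(1 / 2 : ℝ)) = (m : ℝ) ^ (-(3 / 2 : ℝ)) * m := by
    rw [show (-(1 / 2 : ℝ)) = -(3 / 2 : ℝ) + 1 by norm_num, Real.rpow_add hm', Real.rpow_one]
  have e2 : (n : ℝ) ^ (-(1 / 2 : ℝ)) = (n : ℝ) ^ (1 / 2 : ℝ) * (n : ℝ)⁻¹ := by
    rw [show (-(1 / 2 : ℝ)) = (1 / 2 : ℝ) + (-1) by norm_num, Real.rpow_add hn', Real.rpow_neg_one]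
  rw [e1, e2, hlog, neg_sq]
  have key : (m : ℝ) * (n : ℝ)⁻¹ * Real.exp (-(L₂ ^ 2 * u ^ 2))
      ≤ Real.exp (-(u₀ * (L₂ ^ 2 * u₀ - 1))) := by
    rw [← div_eq_mul_inv, hmn, ← Real.exp_add]
    exact Real.exp_le_exp.mpr (by linarith [sub_sq_le_of_le hu₀ huu])
  have h0 : 0 ≤ (m : ℝ) ^ (-(3 / 2 : ℝ)) * (n : ℝ) ^ (1 / 2 : ℝ) := by positivity
  calc (m : ℝ) ^ (-(3 / 2 : ℝ)) * m * ((n : ℝ) ^ (1 / 2 : ℝ) * (n : ℝ)⁻¹) *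
        Real.exp (-(L₂ ^ 2 * u ^ 2))
      = (m : ℝ) ^ (-(3 / 2 : ℝ)) * (n : ℝ) ^ (1 / 2 : ℝ) *
          ((m : ℝ) * (n : ℝ)⁻¹ * Real.exp (-(L₂ ^ 2 * u ^ 2))) := by ring
    _ ≤ (m : ℝ) ^ (-(3 / 2 : ℝ)) * (n : ℝ) ^ (1 / 2 : ℝ) *
          Real.exp (-(u₀ * (L₂ ^ 2 * u₀ - 1))) := mul_le_mul_of_nonneg_left key h0

/-- `|a(m)|m^{−3/2} = ‖term a (3/2) m‖` for `m ≥ 1`. [folklore] -/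
private theorem norm_term_three_halves (a : ℕ → ℂ) {m : ℕ} (hm : m ≠ 0) :
    ‖LSeries.term a (3 / 2 : ℂ) m‖ = ‖a m‖ * (m : ℝ) ^ (-(3 / 2 : ℝ)) := by
  have hm' : (0 : ℝ) < m := Nat.cast_pos.mpr (Nat.pos_of_ne_zero hm)
  rw [LSeries.norm_term_eq, if_neg hm, Real.rpow_neg hm'.le, div_eq_mul_inv]
  norm_num

/-! ## The off-diagonal part -/

/-- **The terms with `m ≠ n`, for one `m`** (`S ⊆ [1,N]`, `N < p`, `𝓛₂²log(p/N) ≥ 1`, weights with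
`|X(m,n)| ≤ X₁` for `m ≠ n`, `m < p` and `|X(m,n)| ≤ X₂` for `m ≥ p`, `X₁, X₂ ≥ 0`):
`Σ_{n∈S, n≠m} |T(m,n)X(m,n)| ≤ ‖a(m)m^{−3/2}‖·(Σ_{n∈S}|b(n)|√n)·(X₁e^{1/(4𝓛₂²)} + X₂e^{−u₀(𝓛₂²u₀−1)})`.
[cite: Zhang2022LandauSiegel, §17 p. 96 ("By trivial estimation")] -/
theorem sum_norm_offDiagonal_le {L₂ : ℝ} (hL : 0 < L₂) (t₀ : ℝ) (a b : ℕ → ℂ) {S : Finset ℕ}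
    {N p : ℕ} (hS : ∀ n ∈ S, n ≠ 0 ∧ n ≤ N) (hNp : N < p)
    (hu₀ : 1 ≤ L₂ ^ 2 * Real.log ((p : ℝ) / N)) (X : ℕ → ℕ → ℂ) {X₁ X₂ : ℝ} (hX₁ : 0 ≤ X₁)
    (hX₂ : 0 ≤ X₂) (hX1 : ∀ m n, n ∈ S → m ≠ n → m < p → ‖X m n‖ ≤ X₁)
    (hX2 : ∀ m n, n ∈ S → p ≤ m → ‖X m n‖ ≤ X₂) (m : ℕ) :
    ∑ n ∈ S.filter (fun n => n ≠ m),
        ‖LSeries.term a (s0 t₀) m * (b n * (n : ℂ) ^ (s0 t₀ - 1)) *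
          cexp (-(L₂ : ℂ) ^ 2 * (Real.log ((n : ℝ) / m) : ℂ) ^ 2) * X m n‖
      ≤ ‖LSeries.term a (3 / 2 : ℂ) m‖ * (∑ n ∈ S, ‖b n‖ * Real.sqrt n) *
          (X₁ * Real.exp (1 / (4 * L₂ ^ 2)) +
            X₂ * Real.exp (-(Real.log ((p : ℝ) / N) * (L₂ ^ 2 * Real.log ((p : ℝ) / N) - 1)))) := by
  rcases eq_or_ne m 0 with rfl | hm
  · simp [LSeries.term_zero]
  set E₁ : ℝ := Real.exp (1 / (4 * L₂ ^ 2)) with hE₁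
  set E₂ : ℝ := Real.exp (-(Real.log ((p : ℝ) / N) * (L₂ ^ 2 * Real.log ((p : ℝ) / N) - 1))) with hE₂
  have hE₁0 : 0 ≤ E₁ := (Real.exp_pos _).le
  have hE₂0 : 0 ≤ E₂ := (Real.exp_pos _).le
  -- termwise bound
  have hterm : ∀ n ∈ S.filter (fun n => n ≠ m),
      ‖LSeries.term a (s0 t₀) m * (b n * (n : ℂ) ^ (s0 t₀ - 1)) *
          cexp (-(L₂ : ℂ) ^ 2 * (Real.log ((n : ℝ) / m) : ℂ) ^ 2) * X m n‖
        ≤ ‖LSeries.term a (3 / 2 : ℂ) m‖ * (‖b n‖ * Real.sqrt n) * (X₁ * E₁ + X₂ * E₂) := by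
    intro n hn
    obtain ⟨hnS, hnm⟩ := Finset.mem_filter.mp hn
    obtain ⟨hn0, hnN⟩ := hS n hnS
    rw [norm_mul, norm_term_mul_eq t₀ a b hm hn0, norm_term_three_halves a hm,
      Real.sqrt_eq_rpow]
    have hab : 0 ≤ ‖a m‖ * ‖b n‖ := mul_nonneg (norm_nonneg _) (norm_nonneg _)
    have hpow : 0 ≤ (m : ℝ) ^ (-(3 / 2 : ℝ)) * (n : ℝ) ^ (1 / 2 : ℝ) := by positivity
    by_cases hmp : m < p
    · -- near terms: `|X| ≤ X₁`, Gaussian bound `E₁`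
      have h1 := rpow_mul_rpow_mul_exp_le hL hm hn0
      have hX := hX1 m n hnS (Ne.symm hnm) hmp
      calc ‖a m‖ * (m : ℝ) ^ (-(1 / 2 : ℝ)) * (‖b n‖ * (n : ℝ) ^ (-(1 / 2 : ℝ))) *
            Real.exp (-(L₂ ^ 2 * Real.log ((n : ℝ) / m) ^ 2)) * ‖X m n‖
          = ‖a m‖ * ‖b n‖ * ((m : ℝ) ^ (-(1 / 2 : ℝ)) * (n : ℝ) ^ (-(1 / 2 : ℝ)) *
              Real.exp (-(L₂ ^ 2 * Real.log ((n : ℝ) / m) ^ 2))) * ‖X m n‖ := by ring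
        _ ≤ ‖a m‖ * ‖b n‖ * ((m : ℝ) ^ (-(3 / 2 : ℝ)) * (n : ℝ) ^ (1 / 2 : ℝ) * E₁) * X₁ := by
            gcongr
        _ ≤ ‖a m‖ * (m : ℝ) ^ (-(3 / 2 : ℝ)) * (‖b n‖ * (n : ℝ) ^ (1 / 2 : ℝ)) *
              (X₁ * E₁ + X₂ * E₂) := by
            have : 0 ≤ ‖a m‖ * ‖b n‖ * ((m : ℝ) ^ (-(3 / 2 : ℝ)) * (n : ℝ) ^ (1 / 2 : ℝ)) *
                (X₂ * E₂) := by positivity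
            nlinarith
    · -- far terms: `|X| ≤ X₂`, Gaussian bound `E₂`
      have hmp : p ≤ m := not_lt.mp hmp
      have h1 := rpow_mul_rpow_mul_exp_le_far (L₂ := L₂) hn0 hnN hNp hmp hu₀
      have hX := hX2 m n hnS hmp
      calc ‖a m‖ * (m : ℝ) ^ (-(1 / 2 : ℝ)) * (‖b n‖ * (n : ℝ) ^ (-(1 / 2 : ℝ))) *
            Real.exp (-(L₂ ^ 2 * Real.log ((n : ℝ) / m) ^ 2)) * ‖X m n‖
          = ‖a m‖ * ‖b n‖ * ((m : ℝ) ^ (-(1 / 2 : ℝ)) * (n : ℝ) ^ (-(1 / 2 : ℝ)) *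
              Real.exp (-(L₂ ^ 2 * Real.log ((n : ℝ) / m) ^ 2))) * ‖X m n‖ := by ring
        _ ≤ ‖a m‖ * ‖b n‖ * ((m : ℝ) ^ (-(3 / 2 : ℝ)) * (n : ℝ) ^ (1 / 2 : ℝ) * E₂) * X₂ := by
            gcongr
        _ ≤ ‖a m‖ * (m : ℝ) ^ (-(3 / 2 : ℝ)) * (‖b n‖ * (n : ℝ) ^ (1 / 2 : ℝ)) *
              (X₁ * E₁ + X₂ * E₂) := by
            have : 0 ≤ ‖a m‖ * ‖b n‖ * ((m : ℝ) ^ (-(3 / 2 : ℝ)) * (n : ℝ) ^ (1 / 2 : ℝ)) *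
                (X₁ * E₁) := by positivity
            nlinarith
  calc ∑ n ∈ S.filter (fun n => n ≠ m),
        ‖LSeries.term a (s0 t₀) m * (b n * (n : ℂ) ^ (s0 t₀ - 1)) *
          cexp (-(L₂ : ℂ) ^ 2 * (Real.log ((n : ℝ) / m) : ℂ) ^ 2) * X m n‖
      ≤ ∑ n ∈ S.filter (fun n => n ≠ m),
          ‖LSeries.term a (3 / 2 : ℂ) m‖ * (‖b n‖ * Real.sqrt n) * (X₁ * E₁ + X₂ * E₂) :=
        Finset.sum_le_sum hterm
    _ ≤ ∑ n ∈ S, ‖LSeries.term a (3 / 2 : ℂ) m‖ * (‖b n‖ * Real.sqrt n) * (X₁ * E₁ + X₂ * E₂) :=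
        Finset.sum_le_sum_of_subset_of_nonneg (Finset.filter_subset _ _)
          (fun n _ _ => by positivity)
    _ = ‖LSeries.term a (3 / 2 : ℂ) m‖ * (∑ n ∈ S, ‖b n‖ * Real.sqrt n) * (X₁ * E₁ + X₂ * E₂) := by
        rw [Finset.mul_sum, Finset.sum_mul]

/-- **"By trivial estimation, the contribution from the terms with `m ≠ n` is `o(p)`"** (§17 p. 96,
tex L4726; also behind (17.8) and `Z22:§15.u012`), as an explicit inequality: with `T(m,n) =
a(m)m^{−s₀}b(n)n^{s₀−1}e^{−𝓛₂² log²(n/m)}` (the terms produced by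
`SmoothWeight.integral_LSeries_mul_sum_mul_omega`), weights `X` as in `sum_norm_offDiagonal_le`,
`Σ_m |a(m)|m^{−3/2} < ∞`:
`‖Σ_m Σ_{n∈S, n≠m} T(m,n)X(m,n)‖ ≤ (Σ_m|a(m)|m^{−3/2})(Σ_{n∈S}|b(n)|√n)(X₁e^{1/(4𝓛₂²)} + X₂e^{−u₀(𝓛₂²u₀−1)})`,
and the `m`-series is summable. [cite: Zhang2022LandauSiegel, §17 p. 96 ("By trivial estimation")] -/
theorem norm_offDiagonal_le {L₂ : ℝ} (hL : 0 < L₂) (t₀ : ℝ) {a : ℕ → ℂ}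
    (ha : LSeriesSummable a (3 / 2 : ℂ)) (b : ℕ → ℂ) {S : Finset ℕ}
    {N p : ℕ} (hS : ∀ n ∈ S, n ≠ 0 ∧ n ≤ N) (hNp : N < p)
    (hu₀ : 1 ≤ L₂ ^ 2 * Real.log ((p : ℝ) / N)) (X : ℕ → ℕ → ℂ) {X₁ X₂ : ℝ} (hX₁ : 0 ≤ X₁)
    (hX₂ : 0 ≤ X₂) (hX1 : ∀ m n, n ∈ S → m ≠ n → m < p → ‖X m n‖ ≤ X₁)
    (hX2 : ∀ m n, n ∈ S → p ≤ m → ‖X m n‖ ≤ X₂) :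
    Summable (fun m : ℕ => ∑ n ∈ S.filter (fun n => n ≠ m),
        LSeries.term a (s0 t₀) m * (b n * (n : ℂ) ^ (s0 t₀ - 1)) *
          cexp (-(L₂ : ℂ) ^ 2 * (Real.log ((n : ℝ) / m) : ℂ) ^ 2) * X m n) ∧
    ‖∑' m : ℕ, ∑ n ∈ S.filter (fun n => n ≠ m),
        LSeries.term a (s0 t₀) m * (b n * (n : ℂ) ^ (s0 t₀ - 1)) *
          cexp (-(L₂ : ℂ) ^ 2 * (Real.log ((n : ℝ) / m) : ℂ) ^ 2) * X m n‖
      ≤ (∑' m : ℕ, ‖LSeries.term a (3 / 2 : ℂ) m‖) * (∑ n ∈ S, ‖b n‖ * Real.sqrt n) *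
          (X₁ * Real.exp (1 / (4 * L₂ ^ 2)) +
            X₂ * Real.exp (-(Real.log ((p : ℝ) / N) * (L₂ ^ 2 * Real.log ((p : ℝ) / N) - 1)))) := by
  set B : ℝ := ∑ n ∈ S, ‖b n‖ * Real.sqrt n with hB
  set K : ℝ := X₁ * Real.exp (1 / (4 * L₂ ^ 2)) +
    X₂ * Real.exp (-(Real.log ((p : ℝ) / N) * (L₂ ^ 2 * Real.log ((p : ℝ) / N) - 1))) with hK
  have hmaj : Summable fun m : ℕ => ‖LSeries.term a (3 / 2 : ℂ) m‖ * B * K :=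
    ((summable_norm_iff.mpr ha).mul_right _).mul_right _
  have hle : ∀ m : ℕ, ‖∑ n ∈ S.filter (fun n => n ≠ m),
      LSeries.term a (s0 t₀) m * (b n * (n : ℂ) ^ (s0 t₀ - 1)) *
        cexp (-(L₂ : ℂ) ^ 2 * (Real.log ((n : ℝ) / m) : ℂ) ^ 2) * X m n‖
        ≤ ‖LSeries.term a (3 / 2 : ℂ) m‖ * B * K := fun m =>
    (norm_sum_le _ _).trans (sum_norm_offDiagonal_le hL t₀ a b hS hNp hu₀ X hX₁ hX₂ hX1 hX2 m)
  have hsum : Summable (fun m : ℕ => ∑ n ∈ S.filter (fun n => n ≠ m),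
      LSeries.term a (s0 t₀) m * (b n * (n : ℂ) ^ (s0 t₀ - 1)) *
        cexp (-(L₂ : ℂ) ^ 2 * (Real.log ((n : ℝ) / m) : ℂ) ^ 2) * X m n) :=
    Summable.of_norm_bounded hmaj hle
  refine ⟨hsum, ?_⟩
  calc ‖∑' m : ℕ, ∑ n ∈ S.filter (fun n => n ≠ m),
        LSeries.term a (s0 t₀) m * (b n * (n : ℂ) ^ (s0 t₀ - 1)) *
          cexp (-(L₂ : ℂ) ^ 2 * (Real.log ((n : ℝ) / m) : ℂ) ^ 2) * X m n‖
      ≤ ∑' m : ℕ, ‖LSeries.term a (3 / 2 : ℂ) m‖ * B * K := tsum_of_norm_bounded hmaj.hasSum hle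
    _ = (∑' m : ℕ, ‖LSeries.term a (3 / 2 : ℂ) m‖) * B * K := by
        rw [tsum_mul_right, tsum_mul_right]

/-! ## The diagonal and the split -/

/-- **The diagonal terms**: for `n ≥ 1`, `T(n,n) = a(n)b(n)/n` (`e^{−𝓛₂²log²1} = 1`,
`n^{−s₀}n^{s₀−1} = n⁻¹`), so with `X(n,n) = X_d` on `S ∌ 0`:
`Σ_{n∈S} T(n,n)X(n,n) = X_d·Σ_{n∈S} a(n)b(n)/n` ((17.3): `X_d = p − 2` for `Σ*_{ψ (mod p)}`, read
as the printed `p` up to `O(Σ|a(n)b(n)|/n) = o(p)`). [cite: Zhang2022LandauSiegel, §17 (17.3) p. 96] -/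
theorem sum_diagonal_eq {L₂ : ℝ} (t₀ : ℝ) (a b : ℕ → ℂ) {S : Finset ℕ} (hS : 0 ∉ S)
    (X : ℕ → ℕ → ℂ) {Xd : ℂ} (hXd : ∀ n ∈ S, X n n = Xd) :
    ∑ n ∈ S, LSeries.term a (s0 t₀) n * (b n * (n : ℂ) ^ (s0 t₀ - 1)) *
        cexp (-(L₂ : ℂ) ^ 2 * (Real.log ((n : ℝ) / n) : ℂ) ^ 2) * X n n
      = Xd * ∑ n ∈ S, a n * b n / (n : ℂ) := by
  rw [Finset.mul_sum]
  refine Finset.sum_congr rfl fun n hn => ?_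
  have hn0 : n ≠ 0 := fun h => hS (h ▸ hn)
  have hn' : (n : ℝ) ≠ 0 := Nat.cast_ne_zero.mpr hn0
  have hnc : (n : ℂ) ≠ 0 := Nat.cast_ne_zero.mpr hn0
  rw [div_self hn', Real.log_one, hXd n hn, LSeries.term_of_ne_zero hn0,
    Complex.cpow_sub _ _ hnc, Complex.cpow_one]
  have hns : (n : ℂ) ^ (s0 t₀) ≠ 0 := fun h => hnc ((cpow_eq_zero_iff _ _).mp h).1
  push_cast
  rw [zero_pow two_ne_zero, mul_zero, Complex.exp_zero]
  field_simp

/-- **The split of the double sum into diagonal and off-diagonal parts** (the bookkeeping between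
`Z22:§17.u005` and (17.3)): for `S ∌ 0` and weights `X`, provided the off-diagonal `m`-series is
summable (e.g. by `norm_offDiagonal_le`),
`Σ_m Σ_{n∈S} T(m,n)X(m,n) = Σ_{n∈S} T(n,n)X(n,n) + Σ_m Σ_{n∈S, n≠m} T(m,n)X(m,n)`.
[cite: Zhang2022LandauSiegel, §17 (17.3) p. 96] -/
theorem tsum_eq_diagonal_add_offDiagonal {L₂ : ℝ} (t₀ : ℝ) (a b : ℕ → ℂ) {S : Finset ℕ}
    (X : ℕ → ℕ → ℂ)
    (hsum : Summable (fun m : ℕ => ∑ n ∈ S.filter (fun n => n ≠ m),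
        LSeries.term a (s0 t₀) m * (b n * (n : ℂ) ^ (s0 t₀ - 1)) *
          cexp (-(L₂ : ℂ) ^ 2 * (Real.log ((n : ℝ) / m) : ℂ) ^ 2) * X m n)) :
    ∑' m : ℕ, ∑ n ∈ S, LSeries.term a (s0 t₀) m * (b n * (n : ℂ) ^ (s0 t₀ - 1)) *
          cexp (-(L₂ : ℂ) ^ 2 * (Real.log ((n : ℝ) / m) : ℂ) ^ 2) * X m n
      = (∑ n ∈ S, LSeries.term a (s0 t₀) n * (b n * (n : ℂ) ^ (s0 t₀ - 1)) *
          cexp (-(L₂ : ℂ) ^ 2 * (Real.log ((n : ℝ) / n) : ℂ) ^ 2) * X n n) +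
        ∑' m : ℕ, ∑ n ∈ S.filter (fun n => n ≠ m),
          LSeries.term a (s0 t₀) m * (b n * (n : ℂ) ^ (s0 t₀ - 1)) *
            cexp (-(L₂ : ℂ) ^ 2 * (Real.log ((n : ℝ) / m) : ℂ) ^ 2) * X m n := by
  classical
  set T : ℕ → ℕ → ℂ := fun m n => LSeries.term a (s0 t₀) m * (b n * (n : ℂ) ^ (s0 t₀ - 1)) *
    cexp (-(L₂ : ℂ) ^ 2 * (Real.log ((n : ℝ) / m) : ℂ) ^ 2) * X m n with hT
  -- the diagonal as a finitely supported series in `m`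
  set dg : ℕ → ℂ := fun m => if m ∈ S then T m m else 0 with hdg
  have hsplit : ∀ m, ∑ n ∈ S, T m n = dg m + ∑ n ∈ S.filter (fun n => n ≠ m), T m n := by
    intro m
    rw [← Finset.sum_filter_add_sum_filter_not S (fun n => n = m)]
    congr 1
    simp only [hdg]
    by_cases hm : m ∈ S
    · rw [if_pos hm, Finset.filter_eq' S m, if_pos hm, Finset.sum_singleton]
    · rw [if_neg hm, Finset.filter_eq' S m, if_neg hm, Finset.sum_empty]
  have hdg_supp : ∀ m ∉ S, dg m = 0 := fun m hm => by rw [hdg]; exact if_neg hm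
  have hdg_sum : Summable dg := summable_of_ne_finset_zero hdg_supp
  have hdg_tsum : ∑' m, dg m = ∑ n ∈ S, T n n := by
    rw [tsum_eq_sum hdg_supp]
    exact Finset.sum_congr rfl fun m hm => by rw [hdg]; exact if_pos hm
  change ∑' m, ∑ n ∈ S, T m n = (∑ n ∈ S, T n n) + ∑' m, ∑ n ∈ S.filter (fun n => n ≠ m), T m n
  simp_rw [hsplit]
  rw [hdg_sum.tsum_add hsum, hdg_tsum]

end SmoothWeight

end Literature.NumberTheory.LFunctions.Zhang2022
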